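import Literature.MathematicalPhysics.QuantumFieldTheory.Balaban1983to89.B6SectAScalarModelV1
import Literature.MathematicalPhysics.QuantumFieldTheory.Balaban1983to89.B6Eq226CovarianceMoments

/-!
# `Balaban1983to89.B6Eq226ScalarModelV1` — T. Bałaban, *Propagators and renormalization transformations for lattice gauge
# theories. II*, Commun. Math. Phys. **96** (1984) 223–250 [Balaban1984PropagatorsII], Sect. A (2.25)–(2.27) pp. 226–227
# ON THE V1 MULTI-LEVEL TORUS CALCULUS: for the CONCRETE operators `Δ = ∂*∂`, `Q′`, `Q′*`, `R` of `…B6SectAOperatorsV1`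
# (this seat, gen 5) and `Δ′_a`, `G′ = Δ′_a⁻¹`, `(Q′G′²Q′*)⁻¹` of `…B6SectAScalarModelV1` (gen 6, file 1) — every nested family
# of domains, `c ≠ 0`, `a > 0` — the covariance of the Gaussian integral (2.25), taken as its second moments against ANY
# Lebesgue measure on `N(Q′)`, EXISTS (`Z′ > 0`), IS `𝒢 = G′² − G′²Q′*(Q′G′²Q′*)⁻¹Q′G′²` (2.27), and `R = Δ𝒢Δ` (2.26);
# hence (2.17) by the printed Gaussian chain — with NO hypothesis left

statement-level skeleton of published theorems with citation tags; proofs where landed; nothing here is a claim about the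
Yang–Mills mass gap

PDF held: `paper:balaban1984-cmp96-propagators-rt-ii` (journal page = PDF page + 222); pp. 225–227 read AS IMAGES on the ×2
renders `run/shared/lean/pub/pub-balaban/b2b-balaban-ref1/pages/1984-cmp96-propagators-rt-II/…-p003…p005-x2.png`.

CITATION HEADER (lean-in-tree rule).  Cell `lit-balaban` (HOME `run/shared/lean/pub/lit-balaban/`), PHASE-2 proof seat **p21**
(gen 6), B6 fold owner r03, referee ref-4.  WHAT IS REPRODUCED: SKELETON rows **B6.Eq2.24** / **B6.Eq2.27** ((2.25)–(2.27)),
and (2.17) reached by the Gaussian route (**B6.Eq2.17**) — KIND model instance: the abstract theorems of record are p22's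
`…B6Eq226CovarianceMoments.cov225_exists` / `cov225` / `eq226_gaussian` / `eq227_gaussian` / `eq217_gaussian` / `h226_of_cov`
(gen 6), whose letters `Δ`, `Q′`, `Q′*`, `a`, `G′`, `E = (Q′G′²Q′*)⁻¹`, `R` and hypotheses (symmetry, adjointness, (2.11), the
inverse identities, `R` = the orthogonal projection onto `ΔN(Q′)`) are DISCHARGED here by this seat's constructions `lapE`,
`QpE`, `QpsE`, `RE` (`…B6SectAOperatorsV1`), `apE`, `deltaPE`, `GpE`, `CpE` (`…B6SectAScalarModelV1`) on the V1 multi-level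
calculus (`LatticeFieldCalculus`, every `…B6SectADomainsV1.Domains`); the companion on r03's `…B6Eq211.BlockSystem` carrier is
p22's `…B6Eq226BlockSystem`.  Theorems only; nothing restated (the ALGEBRAIC (2.26)–(2.27), where `𝒢` is the formula (2.27),
are `…B6Eq217ScalarModelV1.eq226_V1`/`eq227_V1` (gen 6, file 2); here `𝒢` is the covariance of (2.25) and the formula is
DERIVED).

PRINT (pp. 226–227, verbatim): *"e^{½⟨f,Rf⟩} = Z′⁻¹∫dλδ(Q′λ)e^{−½‖Δλ‖²+⟨Δf,λ⟩}. (2.25) Let us denote by 𝒢 a covariance of the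
Gaussian integral on the right-hand side above. Thus we have R = Δ𝒢Δ. (2.26) It is easy to see that 𝒢 = G′² −
G′²Q′*(Q′G′²Q′*)⁻¹Q′G′². (2.27) This formula, the equality (2.26) and the equalities Q′𝒢 = 𝒢Q′* = 0 imply the representation
(2.17)."*

WHAT IS PROVED (0 sorry, 0 new named facts; axioms standard; `D : Domains P`, `c ≠ 0`, weights `w > 0` on `𝔅`; ℓ² pairings;
`μ′` ANY additive Haar measure on `N(Q′) = ker Q′` — the printed "`dλ δ(Q′λ)`"; `Z′ = ∫dλδ(Q′λ)e^{−½‖Δλ‖²}`).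
`cov225_exists_V1` (`Z′ > 0` and a covariance `T` of (2.25) exists: (2.11) discharged by `eq_zero_of_mem_ker_of_lapE_eq_zero`);
**`cov225_V1`**: for EVERY covariance `T` of (2.25) (`⟨a,Tb⟩·Z′ = ∫dλδ(Q′λ)e^{−½‖Δλ‖²}⟨λ,a⟩⟨λ,b⟩`): (i) `T` maps into `N(Q′)`,
(ii) `T` is symmetric, (iii) `T(Δ²λ) = λ` on `N(Q′)`, (iv) `∫dλδ(Q′λ)e^{−½‖Δλ‖²+⟨λ,J⟩} = e^{½⟨J,TJ⟩}Z′` for every `J`,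
(v) **`T = B6SectA.calG G′ Q′ Q′* (Q′G′²Q′*)⁻¹` (2.27)**, (vi) **(2.26) `Rf = Δ(T(Δf))`** for gen 5's orthogonal projection `R`;
`eq217_V1_gaussian` ((2.17) by the printed chain; the direct route is `…B6Eq217ScalarModelV1.eq217_V1`); `h226_V1`
(`⟨x, Ry⟩ = ⟨Δx, T(Δy)⟩`, the hypothesis `h226` of `…B6Eq228FaddeevPopov.eq230_line3_calG` for the V1 operators).
-/

noncomputable section

open MeasureTheory
open scoped InnerProductSpace

namespace Literature.MathematicalPhysics.QuantumFieldTheory.Balaban1983to89.B6Eq226ScalarModelV1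

open LatticeFieldCalculus B6SectADomainsV1 B6SectAOperatorsV1 B6SectAScalarModelV1

variable {P : Params} (D : Domains P)

/-- **`Z′ > 0` and a covariance of (2.25) EXISTS** for the concrete `Δ = ∂*∂`, `Q′` on V1, for every additive Haar (Lebesgue)
measure `μ′` on `N(Q′)` ("`dλ δ(Q′λ)`"): `Z′ = ∫dλδ(Q′λ)e^{−½‖Δλ‖²} > 0` and there is `T` with
`⟨a,Tb⟩·Z′ = ∫dλδ(Q′λ)e^{−½‖Δλ‖²}⟨λ,a⟩⟨λ,b⟩` ((2.11) discharged: `Δ` is injective on `N(Q′)`, lattice factor `c ≠ 0`).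
[cite: Balaban1984PropagatorsII, (2.25) p.226] -/
theorem cov225_exists_V1 {c : ℝ} (hc : c ≠ 0) (μ' : Measure ↥(B6SectA.gaugeSpace (QpE D))) [μ'.IsAddHaarMeasure] :
    0 < ∫ l : ↥(B6SectA.gaugeSpace (QpE D)), Real.exp (-(1 / 2) * ‖lapE c (l : ScalarSpace P)‖ ^ 2) ∂μ' ∧
    ∃ T : ScalarSpace P →ₗ[ℝ] ScalarSpace P, ∀ a b : ScalarSpace P,
      ⟪a, T b⟫_ℝ * ∫ l : ↥(B6SectA.gaugeSpace (QpE D)), Real.exp (-(1 / 2) * ‖lapE c (l : ScalarSpace P)‖ ^ 2) ∂μ' =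
        ∫ l : ↥(B6SectA.gaugeSpace (QpE D)), Real.exp (-(1 / 2) * ‖lapE c (l : ScalarSpace P)‖ ^ 2) *
          (⟪(l : ScalarSpace P), a⟫_ℝ * ⟪(l : ScalarSpace P), b⟫_ℝ) ∂μ' :=
  B6Eq226CovarianceMoments.cov225_exists (QpE D) μ' (lapE c) (inner_lapE_left c)
    (eq_zero_of_mem_ker_of_lapE_eq_zero D hc)

/-- **(2.25)–(2.27) BY THE GAUSSIAN ROUTE ON THE V1 MODEL.**  For every nested family of domains, `c ≠ 0`, weights `w > 0`,
ANY additive Haar measure `μ′` on `N(Q′) = ker Q′` and ANY covariance `T` of the Gaussian integral (2.25) (second moments: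
`⟨a,Tb⟩·Z′ = ∫dλδ(Q′λ)e^{−½‖Δλ‖²}⟨λ,a⟩⟨λ,b⟩`): (i) `T` maps into `N(Q′)`, (ii) `T` is symmetric, (iii) `T(Δ²λ) = λ` on `N(Q′)`,
(iv) `∫dλδ(Q′λ)e^{−½‖Δλ‖²+⟨λ,J⟩} = e^{½⟨J,TJ⟩}Z′` for every `J`, (v) **`T = G′² − G′²Q′*(Q′G′²Q′*)⁻¹Q′G′²` (2.27)** for file 1's
`G′ = GpE`, `(Q′G′²Q′*)⁻¹ = CpE`, and (vi) **(2.26) `Rf = Δ(T(Δf))`** for gen 5's orthogonal projection `R = RE` onto `ΔN(Q′)`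
— every hypothesis of p22's `…B6Eq226CovarianceMoments.cov225`/`eq227_gaussian`/`eq226_gaussian` discharged.
[cite: Balaban1984PropagatorsII, (2.25)–(2.27) pp.226–227] -/
theorem cov225_V1 {c : ℝ} (hc : c ≠ 0) {w : SiteIdx D → ℝ} (hw : ∀ i, 0 < w i)
    (μ' : Measure ↥(B6SectA.gaugeSpace (QpE D))) [μ'.IsAddHaarMeasure] (T : ScalarSpace P →ₗ[ℝ] ScalarSpace P)
    (hT : ∀ a b : ScalarSpace P,
      ⟪a, T b⟫_ℝ * ∫ l : ↥(B6SectA.gaugeSpace (QpE D)), Real.exp (-(1 / 2) * ‖lapE c (l : ScalarSpace P)‖ ^ 2) ∂μ' =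
        ∫ l : ↥(B6SectA.gaugeSpace (QpE D)), Real.exp (-(1 / 2) * ‖lapE c (l : ScalarSpace P)‖ ^ 2) *
          (⟪(l : ScalarSpace P), a⟫_ℝ * ⟪(l : ScalarSpace P), b⟫_ℝ) ∂μ') :
    (∀ u, T u ∈ B6SectA.gaugeSpace (QpE D)) ∧ (∀ x y, ⟪T x, y⟫_ℝ = ⟪x, T y⟫_ℝ) ∧
      (∀ n ∈ B6SectA.gaugeSpace (QpE D), T (lapE c (lapE c n)) = n) ∧
      (∀ J, ∫ l : ↥(B6SectA.gaugeSpace (QpE D)),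
          Real.exp (-(1 / 2) * ‖lapE c (l : ScalarSpace P)‖ ^ 2 + ⟪(l : ScalarSpace P), J⟫_ℝ) ∂μ' =
        Real.exp ((1 / 2) * ⟪J, T J⟫_ℝ) *
          ∫ l : ↥(B6SectA.gaugeSpace (QpE D)), Real.exp (-(1 / 2) * ‖lapE c (l : ScalarSpace P)‖ ^ 2) ∂μ') ∧
      T = B6SectA.calG (GpE D hc hw) (QpE D) (QpsE D) (CpE D hc hw) ∧
      ∀ f, RE D c f = lapE c (T (lapE c f)) := by
  obtain ⟨h1, h2, h3, h4⟩ := B6Eq226CovarianceMoments.cov225 (QpE D) μ' (lapE c) (inner_lapE_left c)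
    (eq_zero_of_mem_ker_of_lapE_eq_zero D hc) T hT
  refine ⟨h1, h2, h3, h4, ?_, fun f => ?_⟩
  · exact B6Eq226CovarianceMoments.eq227_gaussian (QpE D) μ' (lapE c) (inner_lapE_left c)
      (eq_zero_of_mem_ker_of_lapE_eq_zero D hc) T hT (QpsE D) (apE D w) (GpE D hc hw) (CpE D hc hw) (inner_QpsE_left D)
      (inner_apE_left D w) (inner_GpE_left D hc hw) (inner_CpE_left D hc hw) (GpE_comp_deltaPE D hc hw)
      (qggqpE_comp_CpE D hc hw)
  · exact B6Eq226CovarianceMoments.eq226_gaussian (QpE D) μ' (lapE c) (inner_lapE_left c)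
      (eq_zero_of_mem_ker_of_lapE_eq_zero D hc) T hT (KE D c) rfl (RE D c) (RE_apply D c) f

/-- **(2.17) reached by the printed Gaussian chain on the V1 model:** *"This formula, the equality (2.26) and the equalities
Q′𝒢 = 𝒢Q′* = 0 imply the representation (2.17)"* — `R = I − G′Q′*(Q′G′²Q′*)⁻¹Q′G′` for gen 5's orthogonal projection onto
`ΔN(Q′)`, via any covariance of (2.25); the direct route is `…B6Eq217ScalarModelV1.eq217_V1`.
[cite: Balaban1984PropagatorsII, (2.26)–(2.27) ⇒ (2.17) p.227] -/
theorem eq217_V1_gaussian {c : ℝ} (hc : c ≠ 0) {w : SiteIdx D → ℝ} (hw : ∀ i, 0 < w i)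
    (μ' : Measure ↥(B6SectA.gaugeSpace (QpE D))) [μ'.IsAddHaarMeasure] (T : ScalarSpace P →ₗ[ℝ] ScalarSpace P)
    (hT : ∀ a b : ScalarSpace P,
      ⟪a, T b⟫_ℝ * ∫ l : ↥(B6SectA.gaugeSpace (QpE D)), Real.exp (-(1 / 2) * ‖lapE c (l : ScalarSpace P)‖ ^ 2) ∂μ' =
        ∫ l : ↥(B6SectA.gaugeSpace (QpE D)), Real.exp (-(1 / 2) * ‖lapE c (l : ScalarSpace P)‖ ^ 2) *
          (⟪(l : ScalarSpace P), a⟫_ℝ * ⟪(l : ScalarSpace P), b⟫_ℝ) ∂μ') (f : ScalarSpace P) :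
    RE D c f = B6SectA.repr217 (GpE D hc hw) (QpE D) (QpsE D) (CpE D hc hw) f :=
  B6Eq226CovarianceMoments.eq217_gaussian (QpE D) μ' (lapE c) (inner_lapE_left c)
    (eq_zero_of_mem_ker_of_lapE_eq_zero D hc) T hT (QpsE D) (apE D w) (GpE D hc hw) (CpE D hc hw) (inner_QpsE_left D)
    (inner_apE_left D w) (inner_GpE_left D hc hw) (inner_CpE_left D hc hw) (deltaPE_comp_GpE D hc hw)
    (GpE_comp_deltaPE D hc hw) (qggqpE_comp_CpE D hc hw) (CpE_comp_qggqpE D hc hw) (KE D c) rfl (RE D c) (RE_apply D c) f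

/-- **(2.26) in bilinear form on the V1 model**: for a covariance `T` of (2.25) and gen 5's `R`, `⟨x, Ry⟩ = ⟨Δx, T(Δy)⟩` for
all `x, y` — the hypothesis `h226` of p22's `…B6Eq228FaddeevPopov.eq230_line3_calG` (the third line of (2.30), *"The last
equality follows from the identity (2.26)"*, p. 227) for the concrete operators. [cite: Balaban1984PropagatorsII, (2.26) p.226 + (2.30) p.227] -/
theorem h226_V1 {c : ℝ} (hc : c ≠ 0) (μ' : Measure ↥(B6SectA.gaugeSpace (QpE D))) [μ'.IsAddHaarMeasure]
    (T : ScalarSpace P →ₗ[ℝ] ScalarSpace P)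
    (hT : ∀ a b : ScalarSpace P,
      ⟪a, T b⟫_ℝ * ∫ l : ↥(B6SectA.gaugeSpace (QpE D)), Real.exp (-(1 / 2) * ‖lapE c (l : ScalarSpace P)‖ ^ 2) ∂μ' =
        ∫ l : ↥(B6SectA.gaugeSpace (QpE D)), Real.exp (-(1 / 2) * ‖lapE c (l : ScalarSpace P)‖ ^ 2) *
          (⟪(l : ScalarSpace P), a⟫_ℝ * ⟪(l : ScalarSpace P), b⟫_ℝ) ∂μ') (x y : ScalarSpace P) :
    ⟪x, RE D c y⟫_ℝ = ⟪lapE c x, T (lapE c y)⟫_ℝ :=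
  B6Eq226CovarianceMoments.h226_of_cov (QpE D) μ' (lapE c) (inner_lapE_left c)
    (eq_zero_of_mem_ker_of_lapE_eq_zero D hc) T hT (KE D c) rfl (RE D c) (RE_apply D c) x y

end Literature.MathematicalPhysics.QuantumFieldTheory.Balaban1983to89.B6Eq226ScalarModelV1

end
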